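import Literature.Computability.AlgebraicComplexity.IK2020TableauLiftingAlphabet
import HarnessLib

/-!
# Ikenmeyer–Kandasamy 2020, §13: the identity behind the proof of the Main Technical Theorem 4.2
# from the Tableau Lifting Theorem 13.1

Topic `Literature/Computability/AlgebraicComplexity`; theorems only (no definitions, no named
facts). Cell `val-lit`, row IK20-A; brick B1 of the route `IK2020_thm_13_1 → IK2020_thm_4_2` sized in
`HOME/bip/NOTE-p4g5-IK2020Thm42-after-131.md` (val-lit-p4 g5). Source: C. Ikenmeyer, U. Kandasamy,
*Implementing geometric complexity theory: On the separation of orbit closures via symmetries*,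
STOC 2020 = arXiv:1911.03990, §13, proof of Thm. 4.2 (TeX L1146–1210; held text p0019).

In the printed proof, a regular tableau `S` of shape `λ` and content `Dϱ` is lifted (Thm. 13.1) to a
tableau `T = leftpart(T) + rightpart(T)` over the alphabet `[δ]`, and for `g ∈ SL_m` one computes
(display TeX L1192–1206, using claim (∗) TeX L1160–1175 and Cor. 8.3/8.4/8.5):

  `γ(g M_{δ,m} T) = Σ_{φ : [δ]→[m]} γ(g φT) = Σ_{φT regular} γ(g φT) = (±1)² Σ_{φT regular} γ(g rightpart(φT))`
  `= α Σ_{Ŝ ∈ 𝔖_m S} γ(g Ŝ) = (|𝔖_m S| α / m!) · γ(g P_m S)`,  `α ≠ 0`.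

This file proves exactly that identity in the tree's vocabulary — `IK2020.gammaProd` (eq. (8.2),
the tree's definition of `γ(gT)`), `IK2020.ColTableau` with `relabel`/`IsRegular`/`IsDuplex`,
`IK2020.rectTableau`, and the lifted tableau as the PAIR `(L, R)` exactly as in the typed
`IK2020_thm_13_1` — in the division-free form

  `#Stab_{𝔖_m}(S) · Σ_φ γ(g, φL) · γ(g, φR) = #{φ : φT regular, φR = S} · Σ_{π ∈ 𝔖_m} γ(g, πS)`
  (`stab_card_mul_sum_gammaProd_lift_eq`), both counts positive (`card_filter_stab_pos`,
  `card_filter_lift_preimage_pos`),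

from properties (1)–(3) of the Tableau Lifting Theorem, and packages it against the typed fact:
`exists_lift_identity_of_thm_13_1 : IK2020_thm_13_1 → …` (the consumption test of 13.1 AS TYPED).
Ingredients: `gammaProd_rect_eq_one` (Cor. 8.4 + duplex: a regular duplex `m × E` rectangle
evaluates to `1` on `SL_m` — the factor `(±1)²`), `IK2020_cor_8_5` (non-regular colourings vanish),
`card_filter_relabel_eq_of_relabel_eq` (`#{π : πS = Ŝ} = #Stab(S)` for `Ŝ ∈ 𝔖_m S`) and
`card_filter_lift_preimage_eq` (claim (∗): the preimage count is `𝔖_m`-invariant).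

What is NOT here (see the note): the Peter–Weyl input Thm. 9.1/9.2 + (9.3) (linear independence
of the orbit functions `g ↦ γ(g P_m S_{ϱ,i})` for a family of size `Σ b(λ,ϱ,D,d)` — the gap of
record), the `TabM` bridge identifying `Σ_φ γ(g, φL)γ(g, φR)` with the tableau polynomial of `T`
evaluated at `g·p` (Thm. 11.1, tree `TabM.EC_powers`), and the final multiplicity bound.

HONEST FRAMING: bookkeeping of Ikenmeyer–Kandasamy's toy model `p = x₁^D + ⋯ + x_m^D`; VP ≠ VNP
is NOT proved and nothing in this file is progress on it.

## References
* [IkenmeyerKandasamy2019] C. Ikenmeyer, U. Kandasamy, STOC 2020 = arXiv:1911.03990, §13 (proof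
  of Thm. 4.2), §7 (`φT`, `P_m`, `M_{δ,m}`), §8 (Cor. 8.3–8.5), §3 (duplex).

## Tree
`IK2020.gammaProd`, `IK2020.colTopDet`, `IK2020_cor_8_4_sl`, `IK2020_cor_8_5`, `IK2020.ColTableau`
(`relabel`, `IsRegular`, `IsDuplex`, `count`), `IK2020.rectTableau`, `IK2020_thm_13_1`
(`IK20HighestWeightVectors.lean`, val-lit-t08); relabel/duplex plumbing `mk_relabel`, `relabel_relabel`,
`relabel_id`, `IsRegular.relabel`, `isDuplex_rectTableau_iff` (`IK2020TableauLiftingAlphabet.lean`, t08 g4).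
-/

noncomputable section

open scoped BigOperators

namespace Literature.Computability.AlgebraicComplexity

namespace IK2020

namespace ColTableau

variable {α β γ : Type*}

/-- Two relabellings of the same tableau agree iff they agree box by box.
[cite: IkenmeyerKandasamy2019, §7] -/
theorem relabel_eq_relabel_iff {φ ψ : α → β} {T : ColTableau α} :
    T.relabel φ = T.relabel ψ ↔ ∀ c r, φ (T.entry c r) = ψ (T.entry c r) := by
  obtain ⟨C, h, e⟩ := T
  simp only [mk_relabel, ColTableau.mk.injEq, heq_eq_eq, true_and]
  constructor
  · intro hfe c r
    exact congrFun (congrFun hfe c) r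
  · intro hcr
    funext c r
    exact hcr c r

end ColTableau

/-! ### §1 The left part: a regular duplex rectangle of height `m` evaluates to `1` on `SL_m` -/

section LeftPart

variable {k : Type*} [CommRing k] {m E : ℕ}

/-- **Cor. 8.4 + duplex ⇒ `γ(g · leftpart) = 1` on `SL_m`** (IK §13, proof of Thm. 4.2, the factor
`(±1)²`): if every column of the `m × E` rectangle `L` is a bijection onto `[m]` (regular) and
every column occurs an even number of times (duplex), then for `det g = 1` the product of the
column determinants is `1`. [cite: IkenmeyerKandasamy2019, §13 (proof of Thm. 4.2)] -/
theorem gammaProd_rect_eq_one (g : Matrix (Fin m) (Fin m) k) (hg : g.det = 1)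
    (L : Fin E → Fin m → Fin m) (hreg : (rectTableau L).IsRegular) (hdup : (rectTableau L).IsDuplex) :
    gammaProd k g (fun _ : Fin E => m) (fun _ => le_rfl) L = 1 := by
  classical
  rw [isDuplex_rectTableau_iff] at hdup
  unfold gammaProd
  rw [Finset.prod_comp (fun col : Fin m → Fin m => colTopDet k g le_rfl col) L]
  refine Finset.prod_eq_one fun col hcol => ?_
  obtain ⟨c, -, rfl⟩ := Finset.mem_image.mp hcol
  obtain ⟨n, hn⟩ := hdup c
  have hbij : Function.Bijective (L c) := (Finite.injective_iff_bijective).mp (hreg c)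
  rw [hn, ← two_mul, pow_mul]
  rcases IK2020_cor_8_4_sl k g hg (L c) hbij with h1 | h1
  · rw [h1, one_pow, one_pow]
  · rw [h1, neg_one_sq, one_pow]

end LeftPart

/-! ### §2 Counting: stabiliser cosets and the `𝔖_m`-invariance of the preimage count (claim (∗)) -/

section Counting

open scoped Classical

variable {α : Type*} {m : ℕ}

/-- If `Ŝ = π₀ S` then `#{π ∈ 𝔖_m : π S = Ŝ} = #Stab_{𝔖_m}(S)` (translate by `π₀⁻¹`).
[cite: IkenmeyerKandasamy2019, §13 (proof of Thm. 4.2, claim (∗))] -/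
theorem card_filter_relabel_eq_of_relabel_eq (S : ColTableau (Fin m))
    {T : ColTableau (Fin m)} (π₀ : Equiv.Perm (Fin m)) (hT : S.relabel π₀ = T) :
    (Finset.univ.filter fun π : Equiv.Perm (Fin m) => S.relabel π = T).card =
      (Finset.univ.filter fun σ : Equiv.Perm (Fin m) => S.relabel σ = S).card := by
  refine Finset.card_bij (fun π _ => π₀⁻¹ * π) (fun π hπ => ?_) (fun π₁ _ π₂ _ h => ?_)
    (fun σ hσ => ?_)
  · -- maps into the stabiliser
    rw [Finset.mem_filter] at hπ ⊢
    refine ⟨Finset.mem_univ _, ?_⟩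
    have h := hπ.2
    rw [← hT] at h
    rw [ColTableau.relabel_eq_relabel_iff] at h
    conv_rhs => rw [← ColTableau.relabel_id S]
    rw [ColTableau.relabel_eq_relabel_iff]
    intro c r
    rw [Equiv.Perm.coe_mul, Function.comp_apply, h c r]
    simp
  · exact mul_left_cancel h
  · refine ⟨π₀ * σ, ?_, by simp⟩
    rw [Finset.mem_filter] at hσ ⊢
    refine ⟨Finset.mem_univ _, ?_⟩
    rw [← hT, ColTableau.relabel_eq_relabel_iff]
    intro c r
    have h := (ColTableau.relabel_eq_relabel_iff.mp (hσ.2.trans (ColTableau.relabel_id S).symm)) c r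
    rw [Equiv.Perm.coe_mul, Function.comp_apply]
    simpa using congrArg π₀ h

/-- **Claim (∗) of the proof of Thm. 4.2** (TeX L1160–1175): the number of regular colourings
`φ ∈ ℳ_{δ,m}` of the lifted tableau with right part `π S` does not depend on `π ∈ 𝔖_m` ("the
application of `π` gives a bijection between the preimages of `Ŝ` and `π Ŝ`").
[cite: IkenmeyerKandasamy2019, §13 (proof of Thm. 4.2, claim (∗))] -/
theorem card_filter_lift_preimage_eq {δ E : ℕ} (S : ColTableau (Fin m)) (L : Fin E → Fin m → Fin δ)
    (R : (c : Fin S.C) → Fin (S.h c) → Fin δ) (π : Equiv.Perm (Fin m)) :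
    (Finset.univ.filter fun φ : Fin δ → Fin m =>
        (rectTableau fun c r => φ (L c r)).IsRegular ∧
          ((ColTableau.mk S.C S.h R).relabel φ).IsRegular ∧
          (ColTableau.mk S.C S.h R).relabel φ = S.relabel π).card =
    (Finset.univ.filter fun φ : Fin δ → Fin m =>
        (rectTableau fun c r => φ (L c r)).IsRegular ∧
          ((ColTableau.mk S.C S.h R).relabel φ).IsRegular ∧
          (ColTableau.mk S.C S.h R).relabel φ = S).card := by
  have hinv : (⇑π⁻¹ ∘ ⇑π : Fin m → Fin m) = id := by
    funext x
    simp
  have hinv' : (⇑π ∘ ⇑π⁻¹ : Fin m → Fin m) = id := by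
    funext x
    simp
  refine Finset.card_bij (fun φ _ => ⇑π⁻¹ ∘ φ) (fun φ hφ => ?_) (fun φ₁ _ φ₂ _ h => ?_)
    (fun ψ hψ => ?_)
  · rw [Finset.mem_filter] at hφ ⊢
    obtain ⟨-, hL, hR, hRS⟩ := hφ
    refine ⟨Finset.mem_univ _, hL.relabel π⁻¹.injective, hR.relabel π⁻¹.injective, ?_⟩
    change ((ColTableau.mk S.C S.h R).relabel φ).relabel ⇑π⁻¹ = S
    rw [hRS, ColTableau.relabel_relabel, hinv, ColTableau.relabel_id]
  · exact (π⁻¹.injective.comp_left) h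
  · rw [Finset.mem_filter] at hψ
    obtain ⟨-, hL, hR, hRS⟩ := hψ
    refine ⟨⇑π ∘ ψ, ?_, ?_⟩
    · rw [Finset.mem_filter]
      refine ⟨Finset.mem_univ _, hL.relabel π.injective, hR.relabel π.injective, ?_⟩
      change ((ColTableau.mk S.C S.h R).relabel ψ).relabel ⇑π = S.relabel π
      rw [hRS]
    · change (⇑π⁻¹ ∘ ⇑π) ∘ ψ = ψ
      rw [hinv, Function.id_comp]

end Counting

/-! ### §3 The identity: on `SL_m` the tableau function of the lift is a non-zero multiple of the
orbit function of `S` -/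

section Main

open scoped Classical

variable {k : Type*} [CommRing k] {m δ E : ℕ}

/-- **IK 2020, §13, proof of Thm. 4.2 — the core identity** (claim (∗) and the display TeX
L1192–1206: `f̄^S(gp) = 1 · γ(g M_{m,δ} T) = Σ_{φ regular} γ(g φT) = (±1)² Σ_{φ regular} γ(g rightpart(φT))
= α Σ_{Ŝ ∈ 𝔖_m S} γ(g Ŝ) = (|𝔖_m S| α / m!) γ(g P_m S)`), in division-free form and in the tree's
vocabulary (`gammaProd` = eq. (8.2); the lifted tableau as the PAIR `(L, R)` of `IK2020_thm_13_1`):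
for `g ∈ SL_m` and a pair `(L, R)` with properties (1) and (2) of the Tableau Lifting Theorem,

  `#Stab_{𝔖_m}(S) · Σ_{φ : [δ] → [m]} γ(g, φL) γ(g, φR) = #{φ : φT regular, φR = S} · Σ_{π ∈ 𝔖_m} γ(g, πS)`.

Inputs: Cor. 8.5 (non-regular colourings contribute `0`), Cor. 8.4 + duplex (the left factor is
`1`, `gammaProd_rect_eq_one`), the coset count `card_filter_relabel_eq_of_relabel_eq` and claim (∗)
`card_filter_lift_preimage_eq`. Both counts are positive under property (3) of Thm. 13.1
(`card_filter_lift_preimage_pos`, `card_filter_stab_pos`). This is brick B1 of the route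
`IK2020_thm_13_1 → IK2020_thm_4_2` (note `HOME/bip/NOTE-p4g5-IK2020Thm42-after-131.md`).
[cite: IkenmeyerKandasamy2019, §13 (proof of Thm. 4.2)] -/
theorem stab_card_mul_sum_gammaProd_lift_eq (g : Matrix (Fin m) (Fin m) k) (hg : g.det = 1)
    (S : ColTableau (Fin m)) (hS : ∀ c, S.h c ≤ m)
    (L : Fin E → Fin m → Fin δ) (R : (c : Fin S.C) → Fin (S.h c) → Fin δ)
    (h12 : ∀ φ : Fin δ → Fin m, (rectTableau fun c r => φ (L c r)).IsRegular →
      ((ColTableau.mk S.C S.h R).relabel φ).IsRegular →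
        (∃ π : Equiv.Perm (Fin m), (ColTableau.mk S.C S.h R).relabel φ = S.relabel π) ∧
        (rectTableau fun c r => φ (L c r)).IsDuplex) :
    ((Finset.univ.filter fun π : Equiv.Perm (Fin m) => S.relabel π = S).card : k) *
      ∑ φ : Fin δ → Fin m,
        gammaProd k g (fun _ : Fin E => m) (fun _ => le_rfl) (fun c r => φ (L c r)) *
          gammaProd k g S.h hS (fun c r => φ (R c r))
    = ((Finset.univ.filter fun φ : Fin δ → Fin m =>
          (rectTableau fun c r => φ (L c r)).IsRegular ∧
            ((ColTableau.mk S.C S.h R).relabel φ).IsRegular ∧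
            (ColTableau.mk S.C S.h R).relabel φ = S).card : k) *
      ∑ π : Equiv.Perm (Fin m), gammaProd k g S.h hS (fun c r => π (S.entry c r)) := by
  -- the counting lemmas, instantiated before destructuring `S`
  have hcoset := fun (φ : Fin δ → Fin m) (π₀ : Equiv.Perm (Fin m))
      (hπ₀ : S.relabel π₀ = (ColTableau.mk S.C S.h R).relabel φ) =>
    card_filter_relabel_eq_of_relabel_eq S π₀ hπ₀
  have hpre := fun π : Equiv.Perm (Fin m) => card_filter_lift_preimage_eq S L R π
  obtain ⟨C, hgt, ent⟩ := S
  simp only [ColTableau.mk_relabel] at h12 hcoset hpre ⊢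
  -- abbreviations
  set reg : (Fin δ → Fin m) → Prop := fun φ =>
    (rectTableau fun c r => φ (L c r)).IsRegular ∧
      (ColTableau.mk C hgt fun c r => φ (R c r)).IsRegular with hreg
  set γR : (Fin δ → Fin m) → k := fun φ => gammaProd k g hgt hS (fun c r => φ (R c r)) with hγR
  set γS : Equiv.Perm (Fin m) → k := fun π => gammaProd k g hgt hS (fun c r => π (ent c r)) with hγS
  set s : ℕ := (Finset.univ.filter fun π : Equiv.Perm (Fin m) =>
    (ColTableau.mk C hgt fun c r => π (ent c r)) = ColTableau.mk C hgt ent).card with hs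
  -- Step 1: only regular colourings contribute, and then the left factor is `1`
  have step1 : ∑ φ : Fin δ → Fin m,
      gammaProd k g (fun _ : Fin E => m) (fun _ => le_rfl) (fun c r => φ (L c r)) * γR φ =
        ∑ φ ∈ Finset.univ.filter reg, γR φ := by
    rw [Finset.sum_filter]
    refine Finset.sum_congr rfl fun φ _ => ?_
    by_cases hφ : reg φ
    · rw [if_pos hφ, gammaProd_rect_eq_one g hg _ hφ.1 (h12 φ hφ.1 hφ.2).2, one_mul]
    · rw [if_neg hφ]
      rcases not_and_or.mp hφ with hL | hR'
      · obtain ⟨c, hc⟩ := not_forall.mp hL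
        rw [IK2020_cor_8_5 k g (fun _ : Fin E => m) (fun _ => le_rfl) (fun c r => φ (L c r)) ⟨c, hc⟩,
          zero_mul]
      · obtain ⟨c, hc⟩ := not_forall.mp hR'
        rw [hγR]
        dsimp only
        rw [IK2020_cor_8_5 k g hgt hS (fun c r => φ (R c r)) ⟨c, hc⟩, mul_zero]
  -- Step 2: for a regular `φ`, `s · γ(φR) = Σ_π [φR = πS] γ(πS)`
  have step2 : ∀ φ, reg φ → (s : k) * γR φ =
      ∑ π : Equiv.Perm (Fin m),
        if (ColTableau.mk C hgt fun c r => φ (R c r)) = ColTableau.mk C hgt (fun c r => π (ent c r))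
        then γS π else 0 := by
    intro φ hφ
    obtain ⟨π₀, hπ₀⟩ := (h12 φ hφ.1 hφ.2).1
    have hval : ∀ π : Equiv.Perm (Fin m),
        (ColTableau.mk C hgt fun c r => φ (R c r)) = ColTableau.mk C hgt (fun c r => π (ent c r)) →
          γS π = γR φ := by
      intro π hπ
      simp only [ColTableau.mk.injEq, heq_eq_eq, true_and] at hπ
      simp only [hγS, hγR, ← hπ]
    rw [← Finset.sum_filter, Finset.sum_congr rfl fun π hπ => hval π (Finset.mem_filter.mp hπ).2,
      Finset.sum_const, nsmul_eq_mul]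
    congr 2
    rw [Finset.filter_congr (s := Finset.univ) fun (π : Equiv.Perm (Fin m)) _ =>
      (eq_comm : (ColTableau.mk C hgt fun c r => φ (R c r)) = ColTableau.mk C hgt (fun c r => π (ent c r)) ↔
        ColTableau.mk C hgt (fun c r => π (ent c r)) = ColTableau.mk C hgt fun c r => φ (R c r))]
    exact (hcoset φ π₀ hπ₀.symm).symm
  -- Step 3: sum over regular `φ`, swap the sums, and use claim (∗)
  rw [step1, Finset.mul_sum]
  rw [Finset.sum_congr rfl fun φ hφ => step2 φ (Finset.mem_filter.mp hφ).2]
  rw [Finset.sum_comm]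
  simp only [← Finset.sum_filter, Finset.sum_const, nsmul_eq_mul, Finset.filter_filter]
  rw [Finset.mul_sum]
  refine Finset.sum_congr rfl fun π _ => ?_
  congr 1
  have := hpre π
  simp only [hreg, and_assoc]
  convert congrArg (Nat.cast (R := k)) this using 3

/-- Under property (3) of the Tableau Lifting Theorem the preimage count of claim (∗) is
positive. [cite: IkenmeyerKandasamy2019, §13 (proof of Thm. 4.2, "α ≠ 0")] -/
theorem card_filter_lift_preimage_pos (S : ColTableau (Fin m)) (L : Fin E → Fin m → Fin δ)
    (R : (c : Fin S.C) → Fin (S.h c) → Fin δ)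
    (h3 : ∃ φ : Fin δ → Fin m, (rectTableau fun c r => φ (L c r)).IsRegular ∧
      ((ColTableau.mk S.C S.h R).relabel φ).IsRegular ∧ (ColTableau.mk S.C S.h R).relabel φ = S) :
    0 < (Finset.univ.filter fun φ : Fin δ → Fin m =>
        (rectTableau fun c r => φ (L c r)).IsRegular ∧
          ((ColTableau.mk S.C S.h R).relabel φ).IsRegular ∧
          (ColTableau.mk S.C S.h R).relabel φ = S).card := by
  obtain ⟨φ, hφ⟩ := h3
  exact Finset.card_pos.mpr ⟨φ, Finset.mem_filter.mpr ⟨Finset.mem_univ _, hφ⟩⟩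

/-- The stabiliser count is positive (it contains the identity).
[cite: IkenmeyerKandasamy2019, §13 (proof of Thm. 4.2)] -/
theorem card_filter_stab_pos (S : ColTableau (Fin m)) :
    0 < (Finset.univ.filter fun π : Equiv.Perm (Fin m) => S.relabel π = S).card :=
  Finset.card_pos.mpr ⟨1, Finset.mem_filter.mpr ⟨Finset.mem_univ _, ColTableau.relabel_perm_one S⟩⟩

/-- **Consumption test of the Tableau Lifting Theorem as typed.** From `IK2020_thm_13_1` (t08's
typed statement, pair `(L, R)` over `Fin δ`): for every regular `S` of shape `λ ⊢_m dD` and content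
`Dϱ` there are `L`, `R` with every symbol used exactly `D` times and positive integers `N`, `s`
such that for all `g ∈ SL_m`, `s · Σ_φ γ(g, φL) γ(g, φR) = N · Σ_{π∈𝔖_m} γ(g, πS)` — the identity the
proof of Thm. 4.2 uses (§13, TeX L1192–1206). [cite: IkenmeyerKandasamy2019, §13 (proof of Thm. 4.2)] -/
theorem exists_lift_identity_of_thm_13_1 (h131 : IK2020_thm_13_1) (D m d : ℕ) (hD : 3 ≤ D)
    (hm : 2 ≤ m) (hodd : Odd D → 2 * (m - 1) ≤ Nat.choose (2 * (D - 1)) (D - 1))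
    (S : ColTableau (Fin m)) (hshape : S.IsShape m (d * D)) (hreg : S.IsRegular)
    (ρ : Fin m → ℕ) (hρ : Antitone ρ) (hρd : ∑ i, ρ i = d) (hcont : ∀ i, S.count i = D * ρ i)
    (g : Matrix (Fin m) (Fin m) k) (hg : g.det = 1) :
    ∃ (L : Fin (eRho D (Finset.univ.val.map ρ) * D) → Fin m →
        Fin (m * eRho D (Finset.univ.val.map ρ) + d))
      (R : (c : Fin S.C) → Fin (S.h c) → Fin (m * eRho D (Finset.univ.val.map ρ) + d))
      (N s : ℕ), 0 < N ∧ 0 < s ∧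
      (∀ u, (rectTableau L).count u + (ColTableau.mk S.C S.h R).count u = D) ∧
      (s : k) * ∑ φ : Fin (m * eRho D (Finset.univ.val.map ρ) + d) → Fin m,
          gammaProd k g (fun _ => m) (fun _ => le_rfl) (fun c r => φ (L c r)) *
            gammaProd k g S.h (fun c => (hshape.2.1 c).2) (fun c r => φ (R c r)) =
        (N : k) * ∑ π : Equiv.Perm (Fin m),
          gammaProd k g S.h (fun c => (hshape.2.1 c).2) (fun c r => π (S.entry c r)) := by
  obtain ⟨L, R, hcount, h12, h3⟩ := h131 D m d hD hm hodd S hshape hreg ρ hρ hρd hcont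
  refine ⟨L, R, _, _, card_filter_lift_preimage_pos S L R h3, card_filter_stab_pos S, hcount, ?_⟩
  rw [stab_card_mul_sum_gammaProd_lift_eq g hg S (fun c => (hshape.2.1 c).2) L R h12]

end Main

end IK2020

end Literature.Computability.AlgebraicComplexity

end
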